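/-
Copyright (c) 2026 the pub-hodgecm-mathlib formalisation cell (harness21).  Prover seat hodgecm-mathlib-K2Liu-p08 (g5), Track B «K2-LIT»,
#184♮ = hLiu418 = `stmt-HodgeConjecture-24832`; #42S organ S1, SPLIT HAND: THE SPLIT WITNESS COORDINATES AT THE (C3) INTEGRATION POINT `B⁻¹ · PD · (x₁ ⊔ 0)` IN
`L ⊗ L⁺_v`-LETTERS (split twin of K2E1-p10 (g4)'s (C3-c) κ-form, which is keyed to the non-split reading at `w₀`).
-/
import Summits.HodgeConjecture.HodgeConjecture.Theorems.K2LiuWitnessCoordinateLeviRow        -- ★ (C3-κ) `halfDiff_reading_levi_mulVec` (F0P2-p07)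
import Summits.HodgeConjecture.HodgeConjecture.Theorems.K2LiuSplitMiddleProfileTransport      -- ★ `splitReading_leviRow` (p08)
import HarnessLib

/-!
# Crux `HLiu418`, #42S organ S1, SPLIT HAND: THE WITNESS COORDINATE `κ` (VALUES IN `(L ⊗ L⁺_v)²`) AT THE LEVI-ROW POINT

Cell `hodgecm-mathlib`, crux item hLiu418 = `stmt-HodgeConjecture-24832`; squad K2 ∕ K2Liu; LEAD F0P6-plan (g14); prover K2Liu-p08 (g5).
THEOREMS ONLY (no `def`, no instance, no notation, no named-fact hypothesis, no `sorry`); lane `--supports stmt-HodgeConjecture-24832 --as helper`.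

WHY.  The split witness of ★ ED. 5 `K2LiuSplitWitnessPackageOfMoverFrameGeneral` carries its frame coordinate `κ : X ≃+ (Fin 2 → L ⊗ L⁺_v)³` with the (K1) letter
`![(κ x).1 j, (κ x).2.1 j, (κ x).2.2 j] ᵥ* P = fun l => halfDiff (e_D⁻¹ (E′⁻¹ (x, 0))) (epsV (j, l))` over the RING `L ⊗ L⁺_v` (`P` invertible, `hPdet`), and the split
reading `κ′` of `κ` (`hκ′`).  ★ (C3-κ) `K2LiuWitnessCoordinateLeviRow.kappa_levi_rows` and K2E1-p10 (g4)'s (C3-c) κ-form are keyed to the NON-SPLIT reading (`κ` valued in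
`(Fin 2 → L_{w₀})³`, `P` over `L_{w₀}`); the split hand needs the same two steps BEFORE evaluation at a place:
* §1 **`rows_eq_smul_of_reading`** (any commutative ring `R`, `P` with `IsUnit P.det`): if `![κ₁ j, κ₂ j, κ₃ j] ᵥ* P = Rd j` and `Rd j l = Σ_{j′} D j j′ · Rd₀ j′ l` with
  `Rd₀ j l = if j = i₀ then r l else 0`, then `κ₁ = fun j => D j i₀ * u 0`, `κ₂ = fun j => D j i₀ * u 1`, `κ₃ = fun j => D j i₀ * u 2`, `u := r ᵥ* P⁻¹`;
* §2 **`kappa_at_leviRow_point`** (tensor datum of ★ (C3-κ), `n = 2`, `M₂ = 3`): with (K1) in `L ⊗ L⁺_v`-letters, the Levi letter `hB` of `p ∈ P_Δ` (★ (C3-a)∕(C3-b) orientation)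
  and a POINT READING `hR : halfDiff (e_D⁻¹ (E′⁻¹ (z, 0))) (epsV (j, l)) = if j = i₀ then r l else 0` (📤 (C3-e) `K2LiuTensorMiddleCellPointReading` at
  `z := frameLin PD (glue x₁ 0)`, `r := cX x₁`), the three `κ`-blocks of `B · z` are `(D j i₀ · u 0)_j`, `(D j i₀ · u 1)_j`, `(D j i₀ · u 2)_j`, `D = blkD (matA p)`,
  `u = r ᵥ* P⁻¹` — ★ `halfDiff_reading_levi_mulVec` + §1; hence (§3 **`splitReading_at_leviRow_point`**, ★ `splitReading_leviRow`) `κ′(B · z)` is the six-block split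
  Levi row `(β″a″, β′a′, α′a′, α″a″, γ′a′, γ″a″)` with `(α, β, γ) := (u 0, u 1, u 2)`, `a′ j = (D j i₀)(w₀)`, `a″ j = (σ D j i₀)(w₀)` — the point at which ★
  `K2LiuSplitWitnessMiddleProfileRow.splitMiddleRows_of_leviRow_reading` reads the witness.  (The (C3) head's point is `B⁻¹ · z` for the letter `hB` of `k`; the consumer
  feeds `(p, B) := (k⁻¹, B⁻¹)`, ★ (C3-κ) docstring.)
References: [Kudla1994] §3 Thm. 3.1; [HarrisKudlaSweet1996] §1 (1.11), (1.15); [Rangarao1993] Lemma 3.2 (3.8).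
HONEST LABEL.  Count-neutral helper: `HC_CM` is proved only modulo the 7 printed citations (2 remaining named inputs: hLiu418 = `stmt-HodgeConjecture-24832`,
h413 = `stmt-HodgeConjecture-24833`) until rung 0 closes.

## References
* [Kudla1994] S. S. Kudla, Israel J. Math. 87 (1994), §3 Thm. 3.1.
* [HarrisKudlaSweet1996] M. Harris, S. Kudla, W. J. Sweet, J. Amer. Math. Soc. 9 (1996), §1 (1.11), (1.15).
* [Rangarao1993] R. Ranga Rao, Pacific J. Math. 157 (1993), Lemma 3.2 (3.8), p. 351.
-/

set_option autoImplicit false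
set_option linter.dupNamespace false -- the mandated namespace repeats `HodgeConjecture.HodgeConjecture`

noncomputable section

open scoped Matrix Kronecker
open NumberField IsDedekindDomain Matrix
open Literature.RepresentationTheory.HeisenbergGroup Literature.RepresentationTheory.HeisenbergGroup.SymplecticMatrix
open Literature.NumberTheory.Automorphic Literature.NumberTheory.Automorphic.UnitaryGroup
open Literature.NumberTheory.GelbartRogawski1991 Literature.NumberTheory.GelbartRogawski1991.GRConstruction
open Literature.NumberTheory.GelbartRogawski1991.UnitaryDualPair
open Literature.NumberTheory.GelbartRogawski1991.UnitaryDualPair.LocalSplitting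
open Literature.NumberTheory.GelbartRogawski1991.AdaptedBlocks
open Literature.NumberTheory.K2Lit.SiegelDoubled
open Summit.HodgeConjecture.HodgeConjecture.Cruxes.HLiu418.K2LiuLocalSWSectionDefs
open Summit.HodgeConjecture.HodgeConjecture.Cruxes.HLiu418.K2LiuWitnessCoordinateLeviRow
open Summit.HodgeConjecture.HodgeConjecture.Cruxes.HLiu418.K2LiuSplitMiddleProfileTransport

namespace Summit.HodgeConjecture.HodgeConjecture.Cruxes.HLiu418.K2LiuSplitWitnessLeviRowPoint

/-! ## §1 Pure linear algebra over a commutative ring: rows of `κ` from a single-row reading -/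

section Rows

variable {R X : Type*} [CommRing R]

/-- **ROWS OF `κ` AT A LEVI-ROW POINT** (any commutative ring, `P` invertible): from the (K1) relation `![κ₁ j, κ₂ j, κ₃ j] ᵥ* P = Rd j`, the Levi row relation
`Rd j l = Σ_{j′} D j j′ · Rd₀ j′ l` and the single-row reading `Rd₀ j l = if j = i₀ then r l else 0`: `κ_b = (D j i₀ · u (b−1))_j` with `u = r ᵥ* P⁻¹`. [folklore] -/
theorem rows_eq_smul_of_reading (κ₁ κ₂ κ₃ : Fin 2 → R) (P : Matrix (Fin 3) (Fin 3) R) (hP : IsUnit P.det)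
    (Rd Rd₀ : Fin 2 → Fin 3 → R) (hK1 : ∀ j, ![κ₁ j, κ₂ j, κ₃ j] ᵥ* P = Rd j)
    (D : Matrix (Fin 2) (Fin 2) R) (hlev : ∀ j l, Rd j l = ∑ j', D j j' * Rd₀ j' l)
    (i₀ : Fin 2) (r : Fin 3 → R) (hR : ∀ j l, Rd₀ j l = if j = i₀ then r l else 0) :
    κ₁ = (fun j => D j i₀ * (r ᵥ* P⁻¹) 0) ∧ κ₂ = (fun j => D j i₀ * (r ᵥ* P⁻¹) 1) ∧ κ₃ = (fun j => D j i₀ * (r ᵥ* P⁻¹) 2) := by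
  -- `Rd j = D j i₀ • r`
  have hRd : ∀ j, Rd j = D j i₀ • r := by
    intro j
    funext l
    rw [hlev j l, Pi.smul_apply, smul_eq_mul]
    rw [Finset.sum_eq_single i₀ (fun j' _ hj' => by rw [hR j' l, if_neg hj', mul_zero]) (fun h => absurd (Finset.mem_univ i₀) h), hR i₀ l, if_pos rfl]
  -- invert `P`
  have hinv : ∀ j, ![κ₁ j, κ₂ j, κ₃ j] = (D j i₀) • (r ᵥ* P⁻¹) := fun j => by
    rw [← Matrix.smul_vecMul, ← hRd j, ← hK1 j, Matrix.vecMul_vecMul, Matrix.mul_nonsing_inv _ hP, Matrix.vecMul_one]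
  refine ⟨funext fun j => ?_, funext fun j => ?_, funext fun j => ?_⟩
  · have h := congrFun (hinv j) 0
    simpa using h
  · have h := congrFun (hinv j) 1
    simpa using h
  · have h := congrFun (hinv j) 2
    simpa using h

end Rows

/-! ## §2 The split witness coordinate at the Levi-row point of the tensor datum -/

section Tensor

variable (L : Type) [Field L] [NumberField L] [IsCMField L]
variable {N M : ℕ} (e : Fin N × Fin M ≃ Fin 2)
  (dV : Fin N → L) (hdV : ∀ i, IsCMField.complexConj L (dV i) = dV i)
  (dW : Fin M → L) (hdW : ∀ i, IsCMField.complexConj L (dW i) = dW i)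
variable {M' n' : ℕ} (eW : Fin M × Fin 3 ≃ Fin M') (e' : Fin N × Fin M' ≃ Fin n')
  (dV' : Fin 3 → L) (hdV' : ∀ k, IsCMField.complexConj L (dV' k) = dV' k)
variable (v : HeightOneSpectrum (𝓞 (Fp L))) (w₀ : PlacesOver L v)

/-- **THE THREE `κ`-BLOCKS AT THE LEVI-ROW POINT `B · z`** (split-hand currency: `κ` valued in `(Fin 2 → L ⊗ L⁺_v)³`, `P` over `L ⊗ L⁺_v` as in ★ ED. 5's `hK1`): for
`p ∈ P_Δ` with Levi letter `hB` at the tensor datum and a point `z` whose `Δ⁻`-reading is the single row `i₀` with entries `r` (`hR`, 📤 (C3-e)), the blocks of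
`κ(B · z)` are `(D j i₀ · u b)_j`, `D = blkD (matA p)`, `u = r ᵥ* P⁻¹` (★ (C3-κ) `halfDiff_reading_levi_mulVec` + §1).  The (C3) consumer takes `(p, B) := (k⁻¹, B⁻¹)`.
[cite: Kudla1994, §3 Thm. 3.1] [cite: HarrisKudlaSweet1996, §1 (1.11), (1.15)] -/
theorem kappa_at_leviRow_point
    (hTv : IsUnit (localGram (Fp L) (n' + n') (gramD (Fp L) n' (gramR L e' dV hdV (tensorFrame L dW eW dV') (tensorFrame_real L dW hdW eW dV' hdV'))) v).det)
    (E' : LocalSp (Fp L) (n' + n') (gramD (Fp L) n' (gramR L e' dV hdV (tensorFrame L dW eW dV') (tensorFrame_real L dW hdW eW dV' hdV'))) v)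
    (P : Matrix (Fin 3) (Fin 3) (LocalRing L v)) (hPdet : IsUnit P.det)
    (κ : (Fin (n' + n') → v.adicCompletion (Fp L)) → ((Fin 2 → LocalRing L v) × (Fin 2 → LocalRing L v) × (Fin 2 → LocalRing L v)))
    (hK1 : ∀ (x : Fin (n' + n') → v.adicCompletion (Fp L)) (j : Fin 2), ![(κ x).1 j, (κ x).2.1 j, (κ x).2.2 j] ᵥ* P = fun l =>
      halfDiff ((eD (Fp L) L (IsCMField.complexConj L) (complexConj_imagUnit L) (imagUnit_ne_zero L) (imagUnit_mul_self L) v n').symm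
        (toLin (Fp L) v E'⁻¹ (x, 0))) (epsV e eW e' (j, l)))
    (p : UnitaryGroup.localPi L (IsCMField.complexConj L) (2 + 2) (hermD L e dV hdV dW hdW) v)
    (hp : IsSiegelDelta (Fp L) L (IsCMField.complexConj L) (complexConj_imagUnit L) (imagUnit_ne_zero L) (imagUnit_mul_self L) v 2
      (gramR_isSymm L e dV hdV dW hdW) (hermD_eq_map_gramD L e dV hdV dW hdW) p)
    (B : GL (Fin (n' + n')) (v.adicCompletion (Fp L)))
    (hB : E' * iotaD (Fp L) L (IsCMField.complexConj L) (complexConj_imagUnit L) (imagUnit_ne_zero L) (imagUnit_mul_self L) v n'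
        (gramR_isSymm L e' dV hdV (tensorFrame L dW eW dV') (tensorFrame_real L dW hdW eW dV' hdV'))
        (hermD_eq_map_gramD L e' dV hdV (tensorFrame L dW eW dV') (tensorFrame_real L dW hdW eW dV' hdV'))
        (tensorEmbLoc L e dV hdV dW hdW eW e' dV' hdV' v p) * E'⁻¹ =
      transportSp (localGram (Fp L) (n' + n') (gramD (Fp L) n' (gramR L e' dV hdV (tensorFrame L dW eW dV') (tensorFrame_real L dW hdW eW dV' hdV'))) v) hTv (levi B))
    (z : Fin (n' + n') → v.adicCompletion (Fp L)) (i₀ : Fin 2) (r : Fin 3 → LocalRing L v)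
    (hR : ∀ (j : Fin 2) (l : Fin 3),
      halfDiff ((eD (Fp L) L (IsCMField.complexConj L) (complexConj_imagUnit L) (imagUnit_ne_zero L) (imagUnit_mul_self L) v n').symm
        (toLin (Fp L) v E'⁻¹ (z, 0))) (epsV e eW e' (j, l)) = if j = i₀ then r l else 0) :
    (κ ((B : Matrix (Fin (n' + n')) (Fin (n' + n')) (v.adicCompletion (Fp L))) *ᵥ z)).1 =
        (fun j => blkD (matA (Fp L) L (IsCMField.complexConj L) v 2 p) j i₀ * (r ᵥ* P⁻¹) 0) ∧
      (κ ((B : Matrix (Fin (n' + n')) (Fin (n' + n')) (v.adicCompletion (Fp L))) *ᵥ z)).2.1 =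
        (fun j => blkD (matA (Fp L) L (IsCMField.complexConj L) v 2 p) j i₀ * (r ᵥ* P⁻¹) 1) ∧
      (κ ((B : Matrix (Fin (n' + n')) (Fin (n' + n')) (v.adicCompletion (Fp L))) *ᵥ z)).2.2 =
        (fun j => blkD (matA (Fp L) L (IsCMField.complexConj L) v 2 p) j i₀ * (r ᵥ* P⁻¹) 2) :=
  rows_eq_smul_of_reading _ _ _ P hPdet
    (fun j l => halfDiff ((eD (Fp L) L (IsCMField.complexConj L) (complexConj_imagUnit L) (imagUnit_ne_zero L) (imagUnit_mul_self L) v n').symm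
      (toLin (Fp L) v E'⁻¹ ((B : Matrix (Fin (n' + n')) (Fin (n' + n')) (v.adicCompletion (Fp L))) *ᵥ z, 0))) (epsV e eW e' (j, l)))
    (fun j l => halfDiff ((eD (Fp L) L (IsCMField.complexConj L) (complexConj_imagUnit L) (imagUnit_ne_zero L) (imagUnit_mul_self L) v n').symm
      (toLin (Fp L) v E'⁻¹ (z, 0))) (epsV e eW e' (j, l)))
    (fun j => hK1 _ j) (blkD (matA (Fp L) L (IsCMField.complexConj L) v 2 p))
    (fun j l => halfDiff_reading_levi_mulVec L e dV hdV dW hdW eW e' dV' hdV' v hTv E' p hp B hB z j l) i₀ r hR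

/-- **THE SPLIT READING AT THE LEVI-ROW POINT**: under the same letters plus the split reading `hκ′` of ★ ED. 5, `κ′(B · z)` IS the six-block split Levi row
`(β″a″, β′a′, α′a′, α″a″, γ′a′, γ″a″)` with `(α, β, γ) := (u 0, u 1, u 2)`, `u = r ᵥ* P⁻¹`, `a′ j = (D j i₀)(w₀)`, `a″ j = (σ (D j i₀))(w₀)`, `D = blkD (matA p)` — the point at
which ★ `K2LiuSplitWitnessMiddleProfileRow.splitMiddleRows_of_leviRow_reading` reads the witness (★ `splitReading_leviRow`).
[cite: Kudla1994, §3 Thm. 3.1] [cite: HarrisKudlaSweet1996, §1 (1.15)] -/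
theorem splitReading_at_leviRow_point
    (hTv : IsUnit (localGram (Fp L) (n' + n') (gramD (Fp L) n' (gramR L e' dV hdV (tensorFrame L dW eW dV') (tensorFrame_real L dW hdW eW dV' hdV'))) v).det)
    (E' : LocalSp (Fp L) (n' + n') (gramD (Fp L) n' (gramR L e' dV hdV (tensorFrame L dW eW dV') (tensorFrame_real L dW hdW eW dV' hdV'))) v)
    (P : Matrix (Fin 3) (Fin 3) (LocalRing L v)) (hPdet : IsUnit P.det)
    (κ : (Fin (n' + n') → v.adicCompletion (Fp L)) → ((Fin 2 → LocalRing L v) × (Fin 2 → LocalRing L v) × (Fin 2 → LocalRing L v)))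
    (hK1 : ∀ (x : Fin (n' + n') → v.adicCompletion (Fp L)) (j : Fin 2), ![(κ x).1 j, (κ x).2.1 j, (κ x).2.2 j] ᵥ* P = fun l =>
      halfDiff ((eD (Fp L) L (IsCMField.complexConj L) (complexConj_imagUnit L) (imagUnit_ne_zero L) (imagUnit_mul_self L) v n').symm
        (toLin (Fp L) v E'⁻¹ (x, 0))) (epsV e eW e' (j, l)))
    (κ' : (Fin (n' + n') → v.adicCompletion (Fp L)) → ((Fin 2 → w₀.1.adicCompletion L) × (Fin 2 → w₀.1.adicCompletion L) × (Fin 2 → w₀.1.adicCompletion L) ×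
      (Fin 2 → w₀.1.adicCompletion L) × (Fin 2 → w₀.1.adicCompletion L) × (Fin 2 → w₀.1.adicCompletion L)))
    (hκ' : ∀ x, κ' x = (fun j => conjLocal L (IsCMField.complexConj L) v ((κ x).2.1 j) w₀, fun j => (κ x).2.1 j w₀, fun j => (κ x).1 j w₀,
        fun j => conjLocal L (IsCMField.complexConj L) v ((κ x).1 j) w₀, fun j => (κ x).2.2 j w₀, fun j => conjLocal L (IsCMField.complexConj L) v ((κ x).2.2 j) w₀))
    (p : UnitaryGroup.localPi L (IsCMField.complexConj L) (2 + 2) (hermD L e dV hdV dW hdW) v)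
    (hp : IsSiegelDelta (Fp L) L (IsCMField.complexConj L) (complexConj_imagUnit L) (imagUnit_ne_zero L) (imagUnit_mul_self L) v 2
      (gramR_isSymm L e dV hdV dW hdW) (hermD_eq_map_gramD L e dV hdV dW hdW) p)
    (B : GL (Fin (n' + n')) (v.adicCompletion (Fp L)))
    (hB : E' * iotaD (Fp L) L (IsCMField.complexConj L) (complexConj_imagUnit L) (imagUnit_ne_zero L) (imagUnit_mul_self L) v n'
        (gramR_isSymm L e' dV hdV (tensorFrame L dW eW dV') (tensorFrame_real L dW hdW eW dV' hdV'))
        (hermD_eq_map_gramD L e' dV hdV (tensorFrame L dW eW dV') (tensorFrame_real L dW hdW eW dV' hdV'))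
        (tensorEmbLoc L e dV hdV dW hdW eW e' dV' hdV' v p) * E'⁻¹ =
      transportSp (localGram (Fp L) (n' + n') (gramD (Fp L) n' (gramR L e' dV hdV (tensorFrame L dW eW dV') (tensorFrame_real L dW hdW eW dV' hdV'))) v) hTv (levi B))
    (z : Fin (n' + n') → v.adicCompletion (Fp L)) (i₀ : Fin 2) (r : Fin 3 → LocalRing L v)
    (hR : ∀ (j : Fin 2) (l : Fin 3),
      halfDiff ((eD (Fp L) L (IsCMField.complexConj L) (complexConj_imagUnit L) (imagUnit_ne_zero L) (imagUnit_mul_self L) v n').symm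
        (toLin (Fp L) v E'⁻¹ (z, 0))) (epsV e eW e' (j, l)) = if j = i₀ then r l else 0) :
    κ' ((B : Matrix (Fin (n' + n')) (Fin (n' + n')) (v.adicCompletion (Fp L))) *ᵥ z) =
      (fun j => conjLocal L (IsCMField.complexConj L) v ((r ᵥ* P⁻¹) 1) w₀ * conjLocal L (IsCMField.complexConj L) v (blkD (matA (Fp L) L (IsCMField.complexConj L) v 2 p) j i₀) w₀,
        fun j => (r ᵥ* P⁻¹) 1 w₀ * blkD (matA (Fp L) L (IsCMField.complexConj L) v 2 p) j i₀ w₀,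
        fun j => (r ᵥ* P⁻¹) 0 w₀ * blkD (matA (Fp L) L (IsCMField.complexConj L) v 2 p) j i₀ w₀,
        fun j => conjLocal L (IsCMField.complexConj L) v ((r ᵥ* P⁻¹) 0) w₀ * conjLocal L (IsCMField.complexConj L) v (blkD (matA (Fp L) L (IsCMField.complexConj L) v 2 p) j i₀) w₀,
        fun j => (r ᵥ* P⁻¹) 2 w₀ * blkD (matA (Fp L) L (IsCMField.complexConj L) v 2 p) j i₀ w₀,
        fun j => conjLocal L (IsCMField.complexConj L) v ((r ᵥ* P⁻¹) 2) w₀ * conjLocal L (IsCMField.complexConj L) v (blkD (matA (Fp L) L (IsCMField.complexConj L) v 2 p) j i₀) w₀) := by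
  obtain ⟨h1, h2, h3⟩ := kappa_at_leviRow_point L e dV hdV dW hdW eW e' dV' hdV' v hTv E' P hPdet κ hK1 p hp B hB z i₀ r hR
  exact splitReading_leviRow (IsCMField.complexConj L) v w₀ κ κ' hκ' (blkD (matA (Fp L) L (IsCMField.complexConj L) v 2 p)) i₀ h1 h2 h3

end Tensor

end Summit.HodgeConjecture.HodgeConjecture.Cruxes.HLiu418.K2LiuSplitWitnessLeviRowPoint

end
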